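import Mathlib
import Literature.MathematicalPhysics.QuantumFieldTheory.Balaban1983to89.B16Sect1Wilson

/-!
# `Balaban1983to89.B16Eq18Proof` — (1.8) of T. Bałaban, *Large field renormalization. II*, Commun. Math. Phys.
**122**, 355–392 (1989) [Balaban1989LargeFieldII], p. 358, PROVED for rectangular parallelepipeds (Phase-2 seat p30 of
the mega-formalization `lit-balaban`, SKELETON row B16.Eq1.8, decl of record `B16Sect1Wilson.Ineq18`; cell paper B16,
PDF held `paper:balaban1989-cmp122-large-field-ii`, journal page = PDF page + 354).

Statement-level skeleton of published theorems with citation tags; proofs where landed; nothing here is a claim about the Yang–Mills mass gap.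

THE ROW.  p. 358 [4] (render p004), verbatim: *"Consider the quadratic form ‖∂B′‖² on the fields B′ defined on Λ, and
equal to 0 on bonds of the graph G₀. Using the fact that Λ is a rectangular parallelepiped contained in a cube of the
size 100M, and that G₀ determines the axial gauge in Λ, we obtain the inequality Σ_{b∈Λ}|B′(b)|² ≦ d(100M)^{d+1}
Σ_{p∈Λ}|(∂B′)(p)|². (1.8) It follows by the same simple argument as in the proof of Lemma 2.4 in [11], it is even
simpler in this case, because we do not have the averaging operations. The inequality is also much more general,
holding for general domains Λ, and graphs G₀ fixing a gauge in Λ, but with different constants."* ([11] =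
[Balaban1984PropagatorsII]; G₀ = the axial-gauge tree graph of [IV] §1, the contours Γ_{y,x} of
[Balaban1984PropagatorsI] (1.7) — the COMB tree.)

WHAT IS PROVED.  Phase 1 typed (1.8) as `B16Sect1Wilson.Ineq18 nB ndB d M := nB ≤ d(100M)^{d+1}·ndB` and proved it for
CUBIC `Λ` (`B16Sect1Wilson.ineq18_cube`, `ineq18_cube_vec`) from the kernel theorem `B6TreeGaugePoincare.ineq2123` =
(2.123) of [11], whose carrier `B6Elimination.block L y` has all sides equal to `L`.  Here *"the same simple argument as
in the proof of Lemma 2.4 in [11]"* — the comb telescoping `B(x, x + e_μ) = Σ (∂₁B)(p(x′))`, Cauchy–Schwarz, and the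
plaquette multiplicity count of [11] p. 244 — is re-run VERBATIM on a rectangular parallelepiped
`box n y = {x : y_i ≦ x_i < y_i + n_i}` with arbitrary sides `n : Fin d → ℕ` (§§1–5 mirror `B6TreeGaugePoincare` §§1–5
lemma by lemma; the side-independent pieces `comb`, `seg`, `segCurl`, `OnSeg`, `curl`, `Cfg`, `coeff_le` are reused from
there), giving for a uniform side bound `K` (`n_i ≦ K`, `1 ≦ K`), in the axial (comb) gauge `B = 0 on treeBonds n y`:

* `ineq18_box_sharp`: `Σ_{b⊂Λ}|B(b)|² ≦ (d − 1)(K − 1)²K^{d−2} Σ_{p⊂Λ}|(∂B)(p)|²` (the intermediate constant of [11]),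
* `ineq18_box_K`:   `Σ_{b⊂Λ}|B(b)|² ≦ dK^d Σ_{p⊂Λ}|(∂B)(p)|²`,
* `ineq18_box`:     **(1.8)** — `B16Sect1Wilson.Ineq18 (Σ_{b⊂Λ}|B(b)|²) (Σ_{p⊂Λ}|(∂B)(p)|²) d M` for every box `Λ` with
  all sides `≦ 100M` (`K = 100M`, `K^d ≦ K^{d+1}`), real-valued `B`; `ineq18_box_vec`: the same for 𝔤-valued `B′`
  (componentwise in an orthonormal basis, `|B′(b)|² = Σ_a B′_a(b)²`), which is the row AS TYPED;
* `box_const`/`treeBonds_const`: a cube is a box — `box (fun _ ↦ L) y = B6Elimination.block L y` and the comb trees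
  agree, so the Phase-1 cube theorems are the special case `n = fun _ ↦ L`.

Conventions = those of `B6TreeGaugePoincare` (0-indexed directions; a bond `(z, μ)` = ⟨z, z + e_μ⟩; *"b ∈ Λ"* = both end
points in `Λ`; a plaquette is recorded once as `(z, j, μ)`, `j < μ`, with its four corners in `Λ`; `(∂B)(p)` =
`B6TreeGaugePoincare.curl`).  No hypothesis beyond the printed tree gauge on `Λ`; axioms = the standard three.  The
printed aside *"(100M)³ for the x₁-axial gauge"* is not touched (cell GAPS G-r2.9).  Quotation re-read by this seat on
render `run/shared/lean/pub/pub-balaban/b2b-balaban-ref1/pages/1989-cmp122-large-field-II/…-p004-x2.png`.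
-/

open Finset

namespace Literature.MathematicalPhysics.QuantumFieldTheory.Balaban1983to89.B16Eq18Proof

open B6BondElimination (unitVec unitVec_apply add_unitVec_apply)
open B6TreeGaugePoincare (Cfg curl comb seg segCurl OnSeg comb_zero seg_apply_self seg_apply_of_lt seg_apply_of_gt
  seg_top seg_bot seg_add_unitVec card_filter_lt_le coeff_le)

noncomputable section

variable {d : ℕ} {n : Fin d → ℕ}

/-! ## §1  The rectangular parallelepiped Λ, its comb tree G₀, inner bonds and plaquettes -/

/-- The rectangular parallelepiped `Λ = {x ∈ ℤ^d : y_i ≦ x_i < y_i + n_i}` with lowest corner `y` and sides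
`n : Fin d → ℕ` — p. 358: *"Λ is a rectangular parallelepiped contained in a cube of the size 100M"*; the cube
`B6Elimination.block L y` of [Balaban1984PropagatorsI] (1.6) is the case `n = fun _ ↦ L` (`box_const`). [cite: Balaban1989LargeFieldII, (1.8) p.358] -/
def box (n : Fin d → ℕ) (y : Fin d → ℤ) : Finset (Fin d → ℤ) :=
  Fintype.piFinset fun i => Finset.Ico (y i) (y i + n i)

/-- Membership in Λ is the pair of inequalities per coordinate. [cite: Balaban1989LargeFieldII, (1.8) p.358] -/
theorem mem_box {y x : Fin d → ℤ} : x ∈ box n y ↔ ∀ i, y i ≤ x i ∧ x i < y i + n i := by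
  simp only [box, Fintype.mem_piFinset, Finset.mem_Ico]

/-- A cube is a box: `box (fun _ ↦ L) y = block L y`. [cite: Balaban1989LargeFieldII, (1.8) p.358] -/
theorem box_const (L : ℕ) (y : Fin d → ℤ) : box (fun _ : Fin d => L) y = B6Elimination.block L y := rfl

/-- The bonds of the graph G₀ of Λ: the COMB tree (the contours Γ_{y,x}, x ∈ Λ, of [Balaban1984PropagatorsI] (1.7) =
the axial gauge tree of [IV] §1): ⟨w, w + e_μ⟩ with w ∈ Λ, w_i = y_i for i < μ, and w + e_μ ∈ Λ — p. 358: *"G₀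
determines the axial gauge in Λ"*. [cite: Balaban1989LargeFieldII, (1.8) p.358] -/
def treeBonds (n : Fin d → ℕ) (y : Fin d → ℤ) : Finset ((Fin d → ℤ) × Fin d) :=
  (box n y ×ˢ (univ : Finset (Fin d))).filter fun b => (∀ i, i < b.2 → b.1 i = y i) ∧ b.1 b.2 + 1 < y b.2 + n b.2

/-- Membership in G₀. [cite: Balaban1989LargeFieldII, (1.8) p.358] -/
theorem mem_treeBonds {y : Fin d → ℤ} {b : (Fin d → ℤ) × Fin d} :
    b ∈ treeBonds n y ↔ b.1 ∈ box n y ∧ (∀ i, i < b.2 → b.1 i = y i) ∧ b.1 b.2 + 1 < y b.2 + n b.2 := by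
  simp only [treeBonds, mem_filter, mem_product, mem_univ, and_true]

/-- For a cube the comb tree is the one of `B6BondElimination.treeBonds`. [cite: Balaban1989LargeFieldII, (1.8) p.358] -/
theorem treeBonds_const (L : ℕ) (y : Fin d → ℤ) :
    treeBonds (fun _ : Fin d => L) y = B6BondElimination.treeBonds L y := rfl

/-- The bonds `b ∈ Λ` of (1.8): unit bonds ⟨z, z + e_μ⟩ with both end points in Λ, i.e. `z ∈ Λ` and `z_μ + 1 <
y_μ + n_μ`. [cite: Balaban1989LargeFieldII, (1.8) p.358] -/
def innerBonds (n : Fin d → ℕ) (y : Fin d → ℤ) : Finset ((Fin d → ℤ) × Fin d) :=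
  (box n y ×ˢ (univ : Finset (Fin d))).filter fun b => b.1 b.2 + 1 < y b.2 + n b.2

/-- Membership in the inner bonds, coordinate form. [cite: Balaban1989LargeFieldII, (1.8) p.358] -/
theorem mem_innerBonds {y : Fin d → ℤ} {b : (Fin d → ℤ) × Fin d} :
    b ∈ innerBonds n y ↔ b.1 ∈ box n y ∧ b.1 b.2 + 1 < y b.2 + n b.2 := by
  simp only [innerBonds, mem_filter, mem_product, mem_univ, and_true]

/-- One step in direction ν stays in Λ iff the ν-th coordinate does. [cite: Balaban1989LargeFieldII, (1.8) p.358] -/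
theorem add_unitVec_mem_box_iff {y w : Fin d → ℤ} (hw : w ∈ box n y) (ν : Fin d) :
    w + unitVec ν ∈ box n y ↔ w ν + 1 < y ν + n ν := by
  have hb := mem_box.1 hw
  constructor
  · intro h
    have := (mem_box.1 h ν).2
    rw [add_unitVec_apply, if_pos rfl] at this
    exact this
  · intro h
    refine mem_box.2 fun i => ?_
    rw [add_unitVec_apply]
    split_ifs with h1
    · have h2 := hb i
      subst h1
      omega
    · have := hb i
      omega

/-- Fidelity: b = ⟨z, z + e_μ⟩ ∈ Λ iff both end points lie in Λ. [cite: Balaban1989LargeFieldII, (1.8) p.358] -/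
theorem mem_innerBonds_iff {y : Fin d → ℤ} {b : (Fin d → ℤ) × Fin d} :
    b ∈ innerBonds n y ↔ b.1 ∈ box n y ∧ b.1 + unitVec b.2 ∈ box n y := by
  rw [mem_innerBonds]
  constructor
  · rintro ⟨hz, hμ⟩
    exact ⟨hz, (add_unitVec_mem_box_iff hz b.2).2 hμ⟩
  · rintro ⟨hz, hz'⟩
    exact ⟨hz, (add_unitVec_mem_box_iff hz b.2).1 hz'⟩

/-- The tree bonds of Λ are bonds inside Λ. [cite: Balaban1989LargeFieldII, (1.8) p.358] -/
theorem treeBonds_subset_innerBonds (y : Fin d → ℤ) : treeBonds n y ⊆ innerBonds n y := fun b hb => by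
  obtain ⟨hz, -, hμ⟩ := mem_treeBonds.1 hb
  exact mem_innerBonds.2 ⟨hz, hμ⟩

/-- The plaquettes `p ∈ Λ` of (1.8), each recorded once as `(z, j, μ)`: lowest corner `z ∈ Λ`, directions `j < μ`, and
`z_j + 1 < y_j + n_j`, `z_μ + 1 < y_μ + n_μ` (all four corners in Λ, `mem_innerPlaq_iff`). [cite: Balaban1989LargeFieldII, (1.8) p.358] -/
def innerPlaq (n : Fin d → ℕ) (y : Fin d → ℤ) : Finset ((Fin d → ℤ) × Fin d × Fin d) :=
  (box n y ×ˢ ((univ : Finset (Fin d)) ×ˢ (univ : Finset (Fin d)))).filter fun p =>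
    p.2.1 < p.2.2 ∧ p.1 p.2.1 + 1 < y p.2.1 + n p.2.1 ∧ p.1 p.2.2 + 1 < y p.2.2 + n p.2.2

/-- Membership in the inner plaquettes, coordinate form. [cite: Balaban1989LargeFieldII, (1.8) p.358] -/
theorem mem_innerPlaq {y : Fin d → ℤ} {p : (Fin d → ℤ) × Fin d × Fin d} :
    p ∈ innerPlaq n y ↔
      p.1 ∈ box n y ∧ p.2.1 < p.2.2 ∧ p.1 p.2.1 + 1 < y p.2.1 + n p.2.1 ∧ p.1 p.2.2 + 1 < y p.2.2 + n p.2.2 := by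
  simp only [innerPlaq, mem_filter, mem_product, mem_univ, and_true]

/-- Fidelity: `(z, j, μ)` is an inner plaquette iff `j < μ` and its four corners `z`, `z + e_j`, `z + e_μ`, `z + e_j +
e_μ` lie in Λ. [cite: Balaban1989LargeFieldII, (1.8) p.358] -/
theorem mem_innerPlaq_iff {y : Fin d → ℤ} {z : Fin d → ℤ} {j μ : Fin d} :
    (z, j, μ) ∈ innerPlaq n y ↔
      j < μ ∧ z ∈ box n y ∧ z + unitVec j ∈ box n y ∧ z + unitVec μ ∈ box n y ∧
        z + unitVec j + unitVec μ ∈ box n y := by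
  simp only [mem_innerPlaq]
  constructor
  · rintro ⟨hz, hjμ, hj, hμ⟩
    have hzj : z + unitVec j ∈ box n y := (add_unitVec_mem_box_iff hz j).2 hj
    refine ⟨hjμ, hz, hzj, (add_unitVec_mem_box_iff hz μ).2 hμ, (add_unitVec_mem_box_iff hzj μ).2 ?_⟩
    rw [add_unitVec_apply, if_neg (ne_of_gt hjμ), add_zero]
    exact hμ
  · rintro ⟨hjμ, hz, hzj, hzμ, -⟩
    exact ⟨hz, hjμ, (add_unitVec_mem_box_iff hz j).1 hzj, (add_unitVec_mem_box_iff hz μ).1 hzμ⟩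

/-! ## §2  The comb telescoping of [11] p. 244 inside Λ: B(x, x + e_μ) = Σ (∂B)(p(x′)) -/

/-- The `k = μ` corner of the comb of `x ∈ Λ` starts a TREE bond of direction `μ`, provided ⟨x, x + e_μ⟩ ∈ Λ.
[cite: Balaban1989LargeFieldII, (1.8) p.358] -/
theorem comb_mem_treeBonds {y x : Fin d → ℤ} (hx : x ∈ box n y) (μ : Fin d)
    (hμ : x μ + 1 < y μ + n μ) : (comb y x μ, μ) ∈ treeBonds n y := by
  have hb := mem_box.1 hx
  refine mem_treeBonds.2 ⟨mem_box.2 fun i => ?_, fun i hi => ?_, ?_⟩ <;> dsimp only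
  · simp only [comb]
    split_ifs
    · constructor <;> [rfl; (have := hb i; omega)]
    · exact hb i
  · simp only [comb, Fin.lt_def] at hi ⊢; rw [if_pos hi]
  · simp only [comb, lt_irrefl, if_false]; exact hμ

/-- The direction-`j` bond at a point `x′` of the `j`-th comb segment is a tree bond. [cite: Balaban1989LargeFieldII, (1.8) p.358] -/
theorem seg_mem_treeBonds {y x : Fin d → ℤ} (hx : x ∈ box n y) (j : Fin d) {t : ℤ}
    (ht : y j ≤ t) (ht' : t + 1 < y j + n j) : (seg y x j t, j) ∈ treeBonds n y := by
  have hb := mem_box.1 hx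
  refine mem_treeBonds.2 ⟨mem_box.2 fun i => ?_, fun i hi => ?_, ?_⟩ <;> dsimp only
  · by_cases h1 : i < j
    · rw [seg_apply_of_lt _ _ h1]; constructor <;> [rfl; (have := hb i; omega)]
    · by_cases h2 : i = j
      · subst h2; rw [seg_apply_self]; omega
      · rw [seg_apply_of_gt _ _ (lt_of_le_of_ne (not_lt.1 h1) (Ne.symm h2))]; exact hb i
  · exact seg_apply_of_lt _ _ hi _
  · simp only [seg_apply_self]; exact ht'

/-- The direction-`j` bond at `x′ + e_μ`, `j < μ`, is a tree bond as well when ⟨x, x + e_μ⟩ ∈ Λ. [cite: Balaban1989LargeFieldII, (1.8) p.358] -/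
theorem seg_add_mem_treeBonds {y x : Fin d → ℤ} (hx : x ∈ box n y) {j μ : Fin d} (hjμ : j < μ)
    (hμ : x μ + 1 < y μ + n μ) {t : ℤ} (ht : y j ≤ t) (ht' : t + 1 < y j + n j) :
    (seg y x j t + unitVec μ, j) ∈ treeBonds n y := by
  have hb := mem_box.1 hx
  have hjne : j ≠ μ := ne_of_lt hjμ
  refine mem_treeBonds.2 ⟨mem_box.2 fun i => ?_, fun i hi => ?_, ?_⟩ <;> dsimp only
  · rw [add_unitVec_apply]
    by_cases h1 : i < j
    · rw [seg_apply_of_lt _ _ h1, if_neg (ne_of_lt (lt_trans h1 hjμ))]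
      constructor <;> [simp; (have := hb i; omega)]
    · by_cases h2 : i = j
      · subst h2; rw [seg_apply_self, if_neg hjne]; omega
      · rw [seg_apply_of_gt _ _ (lt_of_le_of_ne (not_lt.1 h1) (Ne.symm h2))]
        have := hb i
        split_ifs with h3
        · subst h3; omega
        · omega
  · rw [add_unitVec_apply, seg_apply_of_lt _ _ hi, if_neg (ne_of_lt (lt_trans hi hjμ)), add_zero]
  · rw [add_unitVec_apply, seg_apply_self, if_neg hjne, add_zero]; exact ht'

/-- One plaquette: in the tree gauge, `B(x′ + e_j, ·+e_μ) − B(x′, ·+e_μ) = (∂B)(p(x′))`. [cite: Balaban1989LargeFieldII, (1.8) p.358] -/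
theorem step_eq_curl {y x : Fin d → ℤ} (hx : x ∈ box n y) {j μ : Fin d} (hjμ : j < μ)
    (hμ : x μ + 1 < y μ + n μ) (B : Cfg d) (hB : ∀ b ∈ treeBonds n y, B b = 0) {t : ℤ} (ht : y j ≤ t)
    (ht' : t + 1 < y j + n j) :
    B (seg y x j (t + 1), μ) - B (seg y x j t, μ) = curl B (seg y x j t) j μ := by
  rw [curl, hB _ (seg_mem_treeBonds hx j ht ht'), hB _ (seg_add_mem_treeBonds hx hjμ hμ ht ht'),
    seg_add_unitVec]
  ring

/-- One segment: `B((y_{<j}, x_j, x_{>j}), ·+e_μ) − B((y_{<j}, y_j, x_{>j}), ·+e_μ) = Σ_{s < x_j − y_j} (∂B)(p(x′_s))`.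
[cite: Balaban1989LargeFieldII, (1.8) p.358] -/
theorem segment_eq_sum {y x : Fin d → ℤ} (hx : x ∈ box n y) {j μ : Fin d} (hjμ : j < μ)
    (hμ : x μ + 1 < y μ + n μ) (B : Cfg d) (hB : ∀ b ∈ treeBonds n y, B b = 0) :
    B (comb y x j, μ) - B (comb y x (j + 1), μ) =
      ∑ s ∈ range (x j - y j).toNat, segCurl B y x j μ s := by
  have hb := mem_box.1 hx j
  have hn : y j + ((x j - y j).toNat : ℕ) = x j := by
    rw [Int.toNat_of_nonneg (by omega)]; ring
  have key : ∀ s ∈ range (x j - y j).toNat,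
      segCurl B y x j μ s = B (seg y x j (y j + (s + 1 : ℕ)), μ) - B (seg y x j (y j + s), μ) := by
    intro s hs
    rw [mem_range] at hs
    have hs' : (s : ℤ) < x j - y j := by
      have := Int.toNat_of_nonneg (show 0 ≤ x j - y j by omega); omega
    rw [segCurl, ← step_eq_curl hx hjμ hμ B hB (by omega) (by omega)]
    push_cast
    ring_nf
  rw [sum_congr rfl key, sum_range_sub (fun s : ℕ => B (seg y x j (y j + s), μ)), hn, seg_top]
  simp only [Nat.cast_zero, add_zero, seg_bot]

/-- The comb telescoping, `k ≤ μ` steps. [cite: Balaban1989LargeFieldII, (1.8) p.358] -/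
theorem bond_eq_comb_add_sum {y x : Fin d → ℤ} (hx : x ∈ box n y) (μ : Fin d)
    (hμ : x μ + 1 < y μ + n μ) (B : Cfg d) (hB : ∀ b ∈ treeBonds n y, B b = 0) (k : ℕ) (hk : k ≤ μ) :
    B (x, μ) = B (comb y x k, μ) +
      ∑ j ∈ univ.filter (fun j : Fin d => (j : ℕ) < k), ∑ s ∈ range (x j - y j).toNat, segCurl B y x j μ s := by
  induction k with
  | zero => simp [comb_zero]
  | succ k ih =>
    have hkd : k < d := lt_of_lt_of_le (Nat.lt_of_succ_le hk) μ.2.le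
    set j₀ : Fin d := ⟨k, hkd⟩ with hj₀
    have hj₀μ : j₀ < μ := Fin.lt_def.2 (Nat.lt_of_succ_le hk)
    have hfilt : univ.filter (fun j : Fin d => (j : ℕ) < k + 1) =
        insert j₀ (univ.filter (fun j : Fin d => (j : ℕ) < k)) := by
      ext j
      simp only [mem_filter, mem_univ, true_and, mem_insert, Fin.ext_iff, hj₀]
      omega
    have hnot : j₀ ∉ univ.filter (fun j : Fin d => (j : ℕ) < k) := by simp [hj₀]
    rw [ih (Nat.le_of_succ_le hk), hfilt, sum_insert hnot, ← segment_eq_sum hx hj₀μ hμ B hB]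
    simp only [hj₀]
    ring

/-- [11] p. 244 inside Λ, the telescoping identity: for ⟨x, x + e_μ⟩ ∈ Λ in the tree gauge, `B(x, x + e_μ) = Σ_{j<μ}
Σ_{x′ on the j-th segment} (∂B)(p(x′))`. [cite: Balaban1989LargeFieldII, (1.8) p.358] -/
theorem bond_eq_sum_curl {y x : Fin d → ℤ} (hx : x ∈ box n y) (μ : Fin d)
    (hμ : x μ + 1 < y μ + n μ) (B : Cfg d) (hB : ∀ b ∈ treeBonds n y, B b = 0) :
    B (x, μ) = ∑ j ∈ univ.filter (· < μ), ∑ s ∈ range (x j - y j).toNat, segCurl B y x j μ s := by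
  have h := bond_eq_comb_add_sum hx μ hμ B hB μ le_rfl
  rw [hB _ (comb_mem_treeBonds hx μ hμ), zero_add] at h
  convert h using 2
  ext j
  simp only [mem_filter, mem_univ, true_and, Fin.lt_def]

/-! ## §3  Cauchy–Schwarz per bond, with the segment lengths bounded by K − 1 -/

/-- The `j`-th segment of the comb of `x ∈ Λ` has `x_j − y_j ≤ n_j − 1 ≤ K − 1` plaquettes when `n_j ≤ K`. [cite: Balaban1989LargeFieldII, (1.8) p.358] -/
theorem toNat_sub_le {K : ℕ} {y x : Fin d → ℤ} (hx : x ∈ box n y) (j : Fin d) (hK : n j ≤ K) :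
    ((x j - y j).toNat : ℝ) ≤ (K : ℝ) - 1 := by
  have hb := mem_box.1 hx j
  have hK' : ((n j : ℕ) : ℤ) ≤ (K : ℤ) := by exact_mod_cast hK
  have h : (((x j - y j).toNat : ℕ) : ℤ) = x j - y j := Int.toNat_of_nonneg (by omega)
  have h' : (((x j - y j).toNat : ℕ) : ℤ) + 1 ≤ (K : ℤ) := by omega
  have h'' : (((x j - y j).toNat : ℕ) : ℝ) + 1 ≤ (K : ℝ) := by exact_mod_cast h'
  linarith

/-- [11] p. 244 inside Λ: `|B(x, x + e_μ)|² ≤ (d − 1)(K − 1) Σ_{j<μ} Σ_{x′} |(∂B)(p(x′))|²` (Cauchy–Schwarz on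
`bond_eq_sum_curl`; at most `d − 1` segments of at most `K − 1` plaquettes each). [cite: Balaban1989LargeFieldII, (1.8) p.358] -/
theorem bond_sq_le {K : ℕ} {y x : Fin d → ℤ} (hx : x ∈ box n y) (hK : ∀ i, n i ≤ K) (μ : Fin d)
    (hμ : x μ + 1 < y μ + n μ) (B : Cfg d) (hB : ∀ b ∈ treeBonds n y, B b = 0) :
    B (x, μ) ^ 2 ≤ ((d : ℝ) - 1) * ((K : ℝ) - 1) *
      ∑ j ∈ univ.filter (· < μ), ∑ s ∈ range (x j - y j).toNat, segCurl B y x j μ s ^ 2 := by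
  rw [bond_eq_sum_curl hx μ hμ B hB]
  set J := univ.filter (fun j : Fin d => j < μ) with hJ
  have hd : 1 ≤ d := Nat.succ_le_of_lt (lt_of_le_of_lt (Nat.zero_le _) μ.2)
  have hJc : (#J : ℝ) ≤ (d : ℝ) - 1 := by
    have h1 : (#J : ℝ) ≤ ((d - 1 : ℕ) : ℝ) := by exact_mod_cast card_filter_lt_le μ
    rwa [Nat.cast_sub hd, Nat.cast_one] at h1
  have hd' : (0 : ℝ) ≤ (d : ℝ) - 1 := le_trans (Nat.cast_nonneg _) hJc
  have h1 : (∑ j ∈ J, ∑ s ∈ range (x j - y j).toNat, segCurl B y x j μ s) ^ 2 ≤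
      #J * ∑ j ∈ J, (∑ s ∈ range (x j - y j).toNat, segCurl B y x j μ s) ^ 2 := sq_sum_le_card_mul_sum_sq
  have h2 : ∀ j ∈ J, (∑ s ∈ range (x j - y j).toNat, segCurl B y x j μ s) ^ 2 ≤
      ((K : ℝ) - 1) * ∑ s ∈ range (x j - y j).toNat, segCurl B y x j μ s ^ 2 := by
    intro j _
    refine le_trans sq_sum_le_card_mul_sum_sq ?_
    rw [card_range]
    exact mul_le_mul_of_nonneg_right (toNat_sub_le hx j (hK j)) (sum_nonneg fun _ _ => sq_nonneg _)
  calc (∑ j ∈ J, ∑ s ∈ range (x j - y j).toNat, segCurl B y x j μ s) ^ 2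
        ≤ #J * ∑ j ∈ J, (∑ s ∈ range (x j - y j).toNat, segCurl B y x j μ s) ^ 2 := h1
    _ ≤ ((d : ℝ) - 1) * ∑ j ∈ J, (((K : ℝ) - 1) * ∑ s ∈ range (x j - y j).toNat, segCurl B y x j μ s ^ 2) :=
        mul_le_mul hJc (sum_le_sum h2) (sum_nonneg fun _ _ => sq_nonneg _) hd'
    _ = _ := by rw [← mul_sum]; ring

/-! ## §4  The plaquette multiplicity inside Λ -/

/-- The starting points `x` of the bonds ⟨x, x + e_μ⟩ ∈ Λ of direction `μ`. [cite: Balaban1989LargeFieldII, (1.8) p.358] -/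
def bondStarts (n : Fin d → ℕ) (y : Fin d → ℤ) (μ : Fin d) : Finset (Fin d → ℤ) :=
  (box n y).filter fun x => x μ + 1 < y μ + n μ

/-- The lowest corners `z` of the plaquettes `p ∈ Λ` parallel to `(e_j, e_μ)`. [cite: Balaban1989LargeFieldII, (1.8) p.358] -/
def plaqStarts (n : Fin d → ℕ) (y : Fin d → ℤ) (j μ : Fin d) : Finset (Fin d → ℤ) :=
  (box n y).filter fun z => z j + 1 < y j + n j ∧ z μ + 1 < y μ + n μ

/-- Membership in `bondStarts`. [cite: Balaban1989LargeFieldII, (1.8) p.358] -/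
theorem mem_bondStarts {y x : Fin d → ℤ} {μ : Fin d} :
    x ∈ bondStarts n y μ ↔ x ∈ box n y ∧ x μ + 1 < y μ + n μ := by
  simp only [bondStarts, mem_filter]

/-- Membership in `plaqStarts`. [cite: Balaban1989LargeFieldII, (1.8) p.358] -/
theorem mem_plaqStarts {y z : Fin d → ℤ} {j μ : Fin d} :
    z ∈ plaqStarts n y j μ ↔ z ∈ box n y ∧ z j + 1 < y j + n j ∧ z μ + 1 < y μ + n μ := by
  simp only [plaqStarts, mem_filter]

/-- The plaquettes met on the `j`-th segment of the comb of `x`, as a sum over plaquette corners with the indicator of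
`OnSeg`. [cite: Balaban1989LargeFieldII, (1.8) p.358] -/
theorem sum_seg_le_indicator {y x : Fin d → ℤ} (hx : x ∈ box n y) {j μ : Fin d} (hjμ : j < μ)
    (hμ : x μ + 1 < y μ + n μ) (F : (Fin d → ℤ) → ℝ) (hF : ∀ z, 0 ≤ F z) :
    ∑ s ∈ range (x j - y j).toNat, F (seg y x j (y j + s)) ≤
      ∑ z ∈ plaqStarts n y j μ, if OnSeg j x z then F z else 0 := by
  classical
  have hb := mem_box.1 hx
  have hn : (((x j - y j).toNat : ℕ) : ℤ) = x j - y j := Int.toNat_of_nonneg (by have := hb j; omega)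
  set φ : ℕ → (Fin d → ℤ) := fun s => seg y x j (y j + s) with hφ
  have hinj : Set.InjOn φ ↑(range (x j - y j).toNat) := by
    intro s _ s' _ h
    have := congr_fun h j
    simp only [hφ, seg_apply_self] at this
    exact_mod_cast (by omega : (s : ℤ) = s')
  rw [← sum_image hinj, ← sum_filter]
  refine sum_le_sum_of_subset_of_nonneg (fun z hz => ?_) fun z _ _ => hF z
  obtain ⟨s, hs, rfl⟩ := mem_image.1 hz
  simp only [mem_range] at hs
  have hs' : (s : ℤ) < x j - y j := by omega
  have hbj := hb j
  have hmem := (mem_treeBonds.1 (seg_mem_treeBonds hx j (t := y j + s) (by omega) (by omega))).1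
  refine mem_filter.2 ⟨mem_plaqStarts.2 ⟨hmem, ?_, ?_⟩, fun i hi => ?_, ?_⟩
  · simp only [hφ, seg_apply_self]; omega
  · simp only [hφ, seg_apply_of_gt _ _ hjμ]; exact hμ
  · simp only [hφ, seg_apply_of_gt _ _ hi]
  · simp only [hφ, seg_apply_self]; omega

/-- The count of [11] p. 244 inside Λ: a plaquette parallel to `(e_j, e_μ)` with lowest corner `z` lies on the `j`-th
comb segment of at most `(K − 1)K^j` bonds ⟨x, x + e_μ⟩ ∈ Λ (`x` is determined by `z` up to its coordinates before `j`,
`n_i ≤ K` choices each, and `x_j ∈ (z_j, y_j + n_j − 1]`, at most `K − 1` choices), by an explicit injection into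
`(Fin j → range K) × range (K − 1)`. [cite: Balaban1989LargeFieldII, (1.8) p.358] -/
theorem card_onSeg_le {K : ℕ} {y z : Fin d → ℤ} (hz : z ∈ box n y) (hK : ∀ i, n i ≤ K) (j μ : Fin d) :
    #((bondStarts n y μ).filter fun x => OnSeg j x z) ≤ (K - 1) * K ^ (j : ℕ) := by
  classical
  have hzb := mem_box.1 hz
  have hKz : ∀ i, ((n i : ℕ) : ℤ) ≤ (K : ℤ) := fun i => by exact_mod_cast hK i
  set T : Finset ((Fin j → ℕ) × ℕ) :=
    (Fintype.piFinset fun _ : Fin j => range K) ×ˢ range (K - 1) with hT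
  have hTc : #T = (K - 1) * K ^ (j : ℕ) := by
    rw [hT, card_product, Fintype.card_piFinset, prod_const, card_univ, Fintype.card_fin, card_range,
      card_range, mul_comm]
  set ψ : (Fin d → ℤ) → (Fin j → ℕ) × ℕ :=
    fun x => (fun i => (x ⟨i, i.2.trans j.2⟩ - y ⟨i, i.2.trans j.2⟩).toNat, (x j - z j - 1).toNat) with hψ
  rw [← hTc]
  refine card_le_card_of_injOn ψ (fun x hx => ?_) (fun x hx x' hx' h => ?_)
  · rw [mem_coe, mem_filter, mem_bondStarts] at hx
    obtain ⟨⟨hxb, -⟩, -, hlt⟩ := hx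
    have hb := mem_box.1 hxb
    rw [hT, mem_coe, mem_product, Fintype.mem_piFinset]
    refine ⟨fun i => mem_range.2 ?_, mem_range.2 ?_⟩
    · have := hb ⟨i, i.2.trans j.2⟩
      have := hKz ⟨i, i.2.trans j.2⟩
      simp only [hψ]
      omega
    · have := hb j
      have := hzb j
      have := hKz j
      simp only [hψ]
      omega
  · rw [mem_coe, mem_filter, mem_bondStarts] at hx hx'
    obtain ⟨⟨hxb, -⟩, hafter, hlt⟩ := hx
    obtain ⟨⟨hxb', -⟩, hafter', hlt'⟩ := hx'
    have hb := mem_box.1 hxb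
    have hb' := mem_box.1 hxb'
    simp only [hψ, Prod.mk.injEq] at h
    obtain ⟨h1, h2⟩ := h
    funext i
    by_cases hi : i < j
    · have := congr_fun h1 ⟨i, Fin.lt_def.1 hi⟩
      have h3 := hb i
      have h4 := hb' i
      simp only [Fin.eta] at this
      omega
    · by_cases hi' : i = j
      · subst hi'; omega
      · have hji : j < i := lt_of_le_of_ne (not_lt.1 hi) (Ne.symm hi')
        rw [← hafter i hji, ← hafter' i hji]

/-- The multiplicity bound, summed: `Σ_{⟨x,x+e_μ⟩∈Λ} Σ_{x′ on the j-th segment of the comb of x} F(x′) ≤ (K − 1)K^j Σ_{z :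
p(z)∈Λ ∥ (e_j,e_μ)} F(z)` for `F ≥ 0`. [cite: Balaban1989LargeFieldII, (1.8) p.358] -/
theorem multiplicity_le {K : ℕ} {y : Fin d → ℤ} (hK : ∀ i, n i ≤ K) {j μ : Fin d} (hjμ : j < μ)
    (F : (Fin d → ℤ) → ℝ) (hF : ∀ z, 0 ≤ F z) :
    ∑ x ∈ bondStarts n y μ, ∑ s ∈ range (x j - y j).toNat, F (seg y x j (y j + s)) ≤
      (((K - 1) * K ^ (j : ℕ) : ℕ) : ℝ) * ∑ z ∈ plaqStarts n y j μ, F z := by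
  classical
  calc ∑ x ∈ bondStarts n y μ, ∑ s ∈ range (x j - y j).toNat, F (seg y x j (y j + s))
      ≤ ∑ x ∈ bondStarts n y μ, ∑ z ∈ plaqStarts n y j μ, if OnSeg j x z then F z else 0 :=
        sum_le_sum fun x hx =>
          sum_seg_le_indicator (mem_bondStarts.1 hx).1 hjμ (mem_bondStarts.1 hx).2 F hF
    _ = ∑ z ∈ plaqStarts n y j μ, (#((bondStarts n y μ).filter fun x => OnSeg j x z) : ℝ) * F z := by
        rw [sum_comm]
        refine sum_congr rfl fun z _ => ?_
        rw [← sum_filter, sum_const, nsmul_eq_mul]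
    _ ≤ ∑ z ∈ plaqStarts n y j μ, (((K - 1) * K ^ (j : ℕ) : ℕ) : ℝ) * F z :=
        sum_le_sum fun z hz =>
          mul_le_mul_of_nonneg_right (by exact_mod_cast card_onSeg_le (mem_plaqStarts.1 hz).1 hK j μ) (hF z)
    _ = _ := by rw [mul_sum]

/-! ## §5  Assembly: the intermediate constant of [11], `dK^d`, and (1.8) -/

/-- `Σ_{b∈Λ} f(b)` as an iterated sum over directions and starting points. [cite: Balaban1989LargeFieldII, (1.8) p.358] -/
theorem sum_innerBonds_eq (y : Fin d → ℤ) (f : (Fin d → ℤ) × Fin d → ℝ) :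
    ∑ b ∈ innerBonds n y, f b = ∑ μ : Fin d, ∑ x ∈ bondStarts n y μ, f (x, μ) := by
  classical
  rw [innerBonds, sum_filter, sum_product, sum_comm]
  refine sum_congr rfl fun μ _ => ?_
  rw [bondStarts, sum_filter]

/-- `Σ_{p∈Λ} g(p)` as an iterated sum over the direction pairs `j < μ` and the lowest corners. [cite: Balaban1989LargeFieldII, (1.8) p.358] -/
theorem sum_innerPlaq_eq (y : Fin d → ℤ) (g : (Fin d → ℤ) → Fin d → Fin d → ℝ) :
    ∑ p ∈ innerPlaq n y, g p.1 p.2.1 p.2.2 =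
      ∑ μ : Fin d, ∑ j ∈ univ.filter (· < μ), ∑ z ∈ plaqStarts n y j μ, g z j μ := by
  classical
  have lhs : ∑ p ∈ innerPlaq n y, g p.1 p.2.1 p.2.2 = ∑ μ : Fin d, ∑ j : Fin d, ∑ z ∈ box n y,
      if j < μ ∧ z j + 1 < y j + n j ∧ z μ + 1 < y μ + n μ then g z j μ else 0 := by
    rw [innerPlaq, sum_filter, sum_product]
    simp only [sum_product]
    rw [sum_comm]
    refine (sum_congr rfl fun j _ => sum_comm).trans ?_
    rw [sum_comm]
  have rhs : ∑ μ : Fin d, ∑ j ∈ univ.filter (· < μ), ∑ z ∈ plaqStarts n y j μ, g z j μ =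
      ∑ μ : Fin d, ∑ j : Fin d, ∑ z ∈ box n y,
        if j < μ ∧ z j + 1 < y j + n j ∧ z μ + 1 < y μ + n μ then g z j μ else 0 := by
    refine sum_congr rfl fun μ _ => ?_
    rw [sum_filter]
    refine sum_congr rfl fun j _ => ?_
    rw [plaqStarts, sum_filter]
    split_ifs with h
    · exact sum_congr rfl fun z _ => by simp only [h, true_and]
    · exact (sum_eq_zero fun z _ => by simp only [h, false_and, if_false]).symm
  rw [lhs, rhs]

/-- One direction `μ` inside Λ: `Σ_{⟨x,x+e_μ⟩∈Λ} |B(x, x + e_μ)|² ≤ (d − 1)(K − 1)²K^{d−2} Σ_{j<μ} Σ_{p∈Λ ∥ (e_j,e_μ)}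
|(∂B)(p)|²` in the comb gauge, for a uniform side bound `K ≥ 1`. [cite: Balaban1989LargeFieldII, (1.8) p.358] -/
theorem dir_sq_le {K : ℕ} (hK1 : 1 ≤ K) (hK : ∀ i, n i ≤ K) (y : Fin d → ℤ) (μ : Fin d) (B : Cfg d)
    (hB : ∀ b ∈ treeBonds n y, B b = 0) :
    ∑ x ∈ bondStarts n y μ, B (x, μ) ^ 2 ≤ ((d : ℝ) - 1) * ((K : ℝ) - 1) ^ 2 * (K : ℝ) ^ (d - 2) *
      ∑ j ∈ univ.filter (· < μ), ∑ z ∈ plaqStarts n y j μ, curl B z j μ ^ 2 := by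
  classical
  set J := univ.filter (fun j : Fin d => j < μ) with hJ
  have hK1' : (1 : ℝ) ≤ K := by exact_mod_cast hK1
  have hK' : (0 : ℝ) ≤ (K : ℝ) - 1 := by linarith
  have hd' : (0 : ℝ) ≤ (d : ℝ) - 1 := by
    have hd : 1 ≤ d := Nat.succ_le_of_lt (lt_of_le_of_lt (Nat.zero_le _) μ.2)
    have : (1 : ℝ) ≤ d := by exact_mod_cast hd
    linarith
  have step1 : ∑ x ∈ bondStarts n y μ, B (x, μ) ^ 2 ≤
      ((d : ℝ) - 1) * ((K : ℝ) - 1) * ∑ j ∈ J, ∑ x ∈ bondStarts n y μ,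
        ∑ s ∈ range (x j - y j).toNat, curl B (seg y x j (y j + s)) j μ ^ 2 := by
    calc ∑ x ∈ bondStarts n y μ, B (x, μ) ^ 2
        ≤ ∑ x ∈ bondStarts n y μ, ((d : ℝ) - 1) * ((K : ℝ) - 1) *
            ∑ j ∈ J, ∑ s ∈ range (x j - y j).toNat, segCurl B y x j μ s ^ 2 :=
          sum_le_sum fun x hx => bond_sq_le (mem_bondStarts.1 hx).1 hK μ (mem_bondStarts.1 hx).2 B hB
      _ = _ := by rw [← mul_sum, sum_comm]; rfl
  have step2 : ∀ j ∈ J, ∑ x ∈ bondStarts n y μ, ∑ s ∈ range (x j - y j).toNat,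
      curl B (seg y x j (y j + s)) j μ ^ 2 ≤
        ((K : ℝ) - 1) * (K : ℝ) ^ (d - 2) * ∑ z ∈ plaqStarts n y j μ, curl B z j μ ^ 2 := by
    intro j hj
    have hjμ : j < μ := (mem_filter.1 hj).2
    refine le_trans (multiplicity_le hK hjμ (fun z => curl B z j μ ^ 2) fun z => sq_nonneg _) ?_
    refine mul_le_mul_of_nonneg_right ?_ (sum_nonneg fun _ _ => sq_nonneg _)
    rw [Nat.cast_mul, Nat.cast_pow, Nat.cast_sub hK1, Nat.cast_one]
    exact mul_le_mul_of_nonneg_left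
      (pow_le_pow_right₀ hK1' (by have := Fin.lt_def.1 hjμ; have := μ.2; omega)) hK'
  calc ∑ x ∈ bondStarts n y μ, B (x, μ) ^ 2 ≤ _ := step1
    _ ≤ ((d : ℝ) - 1) * ((K : ℝ) - 1) *
          ∑ j ∈ J, (((K : ℝ) - 1) * (K : ℝ) ^ (d - 2) * ∑ z ∈ plaqStarts n y j μ, curl B z j μ ^ 2) :=
        mul_le_mul_of_nonneg_left (sum_le_sum step2) (mul_nonneg hd' hK')
    _ = _ := by rw [← mul_sum]; ring

/-- The intermediate constant of [11] p. 244 inside Λ, summed over the directions: in the comb gauge on Λ with all sides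
`n_i ≤ K`, `1 ≤ K`, `Σ_{b∈Λ}|B(b)|² ≤ (d − 1)(K − 1)²K^{d−2} Σ_{p∈Λ}|(∂B)(p)|²`. [cite: Balaban1989LargeFieldII, (1.8) p.358] -/
theorem ineq18_box_sharp {K : ℕ} (hK1 : 1 ≤ K) (hK : ∀ i, n i ≤ K) (y : Fin d → ℤ) (B : Cfg d)
    (hB : ∀ b ∈ treeBonds n y, B b = 0) :
    ∑ b ∈ innerBonds n y, B b ^ 2 ≤ ((d : ℝ) - 1) * ((K : ℝ) - 1) ^ 2 * (K : ℝ) ^ (d - 2) *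
      ∑ p ∈ innerPlaq n y, curl B p.1 p.2.1 p.2.2 ^ 2 := by
  rw [sum_innerBonds_eq, sum_innerPlaq_eq y (fun z j μ => curl B z j μ ^ 2), mul_sum]
  exact sum_le_sum fun μ _ => dir_sq_le hK1 hK y μ B hB

/-- `Σ_{b∈Λ}|B(b)|² ≤ dK^d Σ_{p∈Λ}|(∂B)(p)|²` for a box with sides `≤ K` in its comb gauge (the constant of (2.123) [11]
with the cube side replaced by the uniform side bound). [cite: Balaban1989LargeFieldII, (1.8) p.358] -/
theorem ineq18_box_K {K : ℕ} (hK1 : 1 ≤ K) (hK : ∀ i, n i ≤ K) (y : Fin d → ℤ) (B : Cfg d)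
    (hB : ∀ b ∈ treeBonds n y, B b = 0) :
    ∑ b ∈ innerBonds n y, B b ^ 2 ≤
      (d : ℝ) * (K : ℝ) ^ d * ∑ p ∈ innerPlaq n y, curl B p.1 p.2.1 p.2.2 ^ 2 :=
  le_trans (ineq18_box_sharp hK1 hK y B hB)
    (mul_le_mul_of_nonneg_right (coeff_le hK1) (sum_nonneg fun _ _ => sq_nonneg _))

/-- **(1.8) for a rectangular parallelepiped, PROVED**: if `Λ = box n y` has all sides `n_i ≤ 100M` (`1 ≤ M`) and the
real bond function `B` vanishes on the bonds of the comb tree `G₀` of Λ, then `Σ_{b∈Λ}|B(b)|² ≤ d(100M)^{d+1}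
Σ_{p∈Λ}|(∂B)(p)|²` — the constant `dK^d` of `ineq18_box_K` at `K = 100M` followed by `K^d ≤ K^{d+1}`. [cite: Balaban1989LargeFieldII, (1.8) p.358] -/
theorem ineq18_box_real (M : ℕ) (hM : 1 ≤ M) (hn : ∀ i, n i ≤ 100 * M) (y : Fin d → ℤ) (B : Cfg d)
    (hB : ∀ b ∈ treeBonds n y, B b = 0) :
    ∑ b ∈ innerBonds n y, B b ^ 2 ≤
      (d : ℝ) * (100 * (M : ℝ)) ^ (d + 1) * ∑ p ∈ innerPlaq n y, curl B p.1 p.2.1 p.2.2 ^ 2 := by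
  have hK1 : 1 ≤ 100 * M := le_trans hM (Nat.le_mul_of_pos_left M (by norm_num))
  refine le_trans (ineq18_box_K hK1 hn y B hB)
    (mul_le_mul_of_nonneg_right ?_ (sum_nonneg fun _ _ => sq_nonneg _))
  have h1 : (1 : ℝ) ≤ 100 * (M : ℝ) := by exact_mod_cast hK1
  have h2 : ((100 * M : ℕ) : ℝ) = 100 * (M : ℝ) := by push_cast; ring
  rw [h2]
  exact mul_le_mul_of_nonneg_left (pow_le_pow_right₀ h1 (Nat.le_succ d)) (Nat.cast_nonneg d)

/-- (1.8) for a rectangular parallelepiped in the typed shape `B16Sect1Wilson.Ineq18` (real-valued `B`). [cite: Balaban1989LargeFieldII, (1.8) p.358] -/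
theorem ineq18_box (M : ℕ) (hM : 1 ≤ M) (hn : ∀ i, n i ≤ 100 * M) (y : Fin d → ℤ) (B : Cfg d)
    (hB : ∀ b ∈ treeBonds n y, B b = 0) :
    B16Sect1Wilson.Ineq18 (∑ b ∈ innerBonds n y, B b ^ 2)
      (∑ p ∈ innerPlaq n y, curl B p.1 p.2.1 p.2.2 ^ 2) d M :=
  ineq18_box_real M hM hn y B hB

/-- **(1.8) AS TYPED, PROVED — rectangular parallelepiped, 𝔤-valued `B′`**: in coordinates `a : Fin D` of an orthonormal
basis of 𝔤 (`|B′(b)|² = Σ_a B′_a(b)²`, `(∂B′)_a = ∂(B′_a)`), for `Λ = box n y` with all sides `≤ 100M` and `B′ = 0` on the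
bonds of the axial-gauge tree `G₀` of Λ: `Σ_{b∈Λ}|B′(b)|² ≦ d(100M)^{d+1} Σ_{p∈Λ}|(∂B′)(p)|²`, i.e.
`B16Sect1Wilson.Ineq18 (Σ_{b∈Λ}|B′(b)|²) (Σ_{p∈Λ}|(∂B′)(p)|²) d M` — removes the TODO(general form) of
`B16Sect1Wilson.ineq18_cube`/`ineq18_cube_vec` (SKELETON row B16.Eq1.8, Phase-2 seat p30). [cite: Balaban1989LargeFieldII, (1.8) p.358] -/
theorem ineq18_box_vec {D : ℕ} (M : ℕ) (hM : 1 ≤ M) (hn : ∀ i, n i ≤ 100 * M) (y : Fin d → ℤ)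
    (B : (Fin d → ℤ) × Fin d → (Fin D → ℝ)) (hB : ∀ b ∈ treeBonds n y, B b = 0) :
    B16Sect1Wilson.Ineq18 (∑ b ∈ innerBonds n y, ∑ a, (B b a) ^ 2)
      (∑ p ∈ innerPlaq n y, ∑ a, curl (fun b => B b a) p.1 p.2.1 p.2.2 ^ 2) d M := by
  unfold B16Sect1Wilson.Ineq18
  have hcomp := fun a : Fin D => ineq18_box_real M hM hn y (fun b => B b a) (fun b hb => by simp [hB b hb])
  calc ∑ b ∈ innerBonds n y, ∑ a, (B b a) ^ 2
      = ∑ a, ∑ b ∈ innerBonds n y, (B b a) ^ 2 := Finset.sum_comm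
    _ ≤ ∑ a : Fin D, (d : ℝ) * (100 * (M : ℝ)) ^ (d + 1) *
          ∑ p ∈ innerPlaq n y, curl (fun b => B b a) p.1 p.2.1 p.2.2 ^ 2 :=
        Finset.sum_le_sum fun a _ => hcomp a
    _ = _ := by rw [← Finset.mul_sum, Finset.sum_comm]

/-- The Phase-1 cube theorem is the special case `n = fun _ ↦ L` of `ineq18_box_real` (knitting: cubes are boxes, the
comb trees agree). [cite: Balaban1989LargeFieldII, (1.8) p.358] -/
theorem ineq18_cube_of_box {L : ℕ} (M : ℕ) (hM : 1 ≤ M) (hLM : L ≤ 100 * M) (y : Fin d → ℤ) (B : Cfg d)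
    (hB : ∀ b ∈ B6BondElimination.treeBonds L y, B b = 0) :
    ∑ b ∈ innerBonds (fun _ : Fin d => L) y, B b ^ 2 ≤
      (d : ℝ) * (100 * (M : ℝ)) ^ (d + 1) *
        ∑ p ∈ innerPlaq (fun _ : Fin d => L) y, curl B p.1 p.2.1 p.2.2 ^ 2 :=
  ineq18_box_real M hM (fun _ => hLM) y B (by rw [treeBonds_const]; exact hB)

end

end Literature.MathematicalPhysics.QuantumFieldTheory.Balaban1983to89.B16Eq18Proof
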